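import Summits.Ventures.PercRepro.LemmaBPlusMatrix

/-!
# A subgraph's cube is a face of the supergraph's cube

For `G : MultiGraph V E'` and `H : MultiGraph V (Fin k)` with an injection `ι : E' → Fin k` matching
endpoints (`SubOf`), a configuration `ρ` of `G` extends to the configuration `ext ι ρ` of `H` (open
exactly on `ι`'s image where `ρ` is open); open adjacency and connectivity agree
(`conn_ext_iff`), so the rows of the marked partition agree (`row4D_ext`).  The extensions are exactly
the configurations below the mask `u_ι` of the image, and the complement extends to the antipode of
the face `[⊥, u_ι]` (`ext_compl`).  Hence **the full-cube class sum of `G` is the face slack of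
`[⊥, u_ι]` in `H`** (`cubeSumC011_eq_faceSlackZ_sub`), and **Lemma B⁺ on every face of `H` gives
`0 ≤ CS(G, m)`** (`cubeSumC011_nonneg_of_facesBPlus_sub`): the kernel facts on `K₅`
(`LemmaBPlusK5.lean`) cover every spanning subgraph.
-/

namespace PercRepro

namespace MultiGraph

variable {V E' : Type*} {k : ℕ} (G : MultiGraph V E') (H : MultiGraph V (Fin k))
  [DecidableEq V] [Fintype V] [Fintype E'] [DecidableEq E']

/-- `G` sits inside `H` along `ι`: the image edges have the same endpoints (in some order). -/
def SubOf (ι : E' → Fin k) : Prop :=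
  Function.Injective ι ∧ ∀ e, (H.fst (ι e) = G.fst e ∧ H.snd (ι e) = G.snd e) ∨
    (H.fst (ι e) = G.snd e ∧ H.snd (ι e) = G.fst e)

/-- The configuration of `H` that is open exactly on `ι e` with `ρ e` open. -/
def ext (ι : E' → Fin k) (ρ : Config E') : Config (Fin k) :=
  fun f => decide (∃ e, ι e = f ∧ ρ e = true)

/-- The mask of the image of `ι`: the extension of the all-open configuration. -/
def imageMask (ι : E' → Fin k) : Config (Fin k) := ext ι ⊤

omit [DecidableEq V] [Fintype V] [DecidableEq E'] in
/-- `ext` on an image edge. -/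
theorem ext_apply (ι : E' → Fin k) (hι : Function.Injective ι) (ρ : Config E') (e : E') :
    ext ι ρ (ι e) = ρ e := by
  unfold ext
  rw [Bool.eq_iff_iff, decide_eq_true_iff]
  constructor
  · rintro ⟨e', he', hρ⟩
    rw [hι he'] at hρ
    exact hρ
  · intro h
    exact ⟨e, rfl, h⟩

omit [DecidableEq V] [Fintype V] [DecidableEq E'] in
/-- `ext` off the image. -/
theorem ext_apply_of_not (ι : E' → Fin k) (ρ : Config E') {f : Fin k} (hf : ∀ e, ι e ≠ f) :
    ext ι ρ f = false := by
  unfold ext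
  rw [decide_eq_false_iff_not]
  rintro ⟨e, he, _⟩
  exact hf e he

omit [DecidableEq V] [Fintype V] [DecidableEq E'] in
/-- Extensions lie below the image mask. -/
theorem ext_le_imageMask (ι : E' → Fin k) (ρ : Config E') : ext ι ρ ≤ imageMask ι := by
  rw [Config.le_iff]
  intro f hf
  unfold ext at hf
  rw [decide_eq_true_iff] at hf
  obtain ⟨e, he, _⟩ := hf
  unfold imageMask ext
  rw [decide_eq_true_iff]
  exact ⟨e, he, rfl⟩

omit [DecidableEq V] [Fintype V] [DecidableEq E'] in
/-- The complement extends to the antipode of the face `[⊥, u_ι]`. -/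
theorem ext_compl (ι : E' → Fin k) (hι : Function.Injective ι) (ρ : Config E') :
    ext ι ρᶜ = antipode (imageMask ι) ⊥ (ext ι ρ) := by
  funext f
  have hbot : (⊥ : Config (Fin k)) f = false := rfl
  by_cases hf : ∃ e, ι e = f
  · obtain ⟨e, rfl⟩ := hf
    have hu : imageMask ι (ι e) = true := by
      unfold imageMask; rw [ext_apply ι hι]; rfl
    simp only [antipode, hbot, hu, ext_apply ι hι, Pi.compl_apply]
    rfl
  · have hf' : ∀ e, ι e ≠ f := fun e he => hf ⟨e, he⟩
    have hu : imageMask ι f = false := ext_apply_of_not ι _ hf'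
    simp only [antipode, hbot, hu, ext_apply_of_not ι _ hf']
    rfl

omit [DecidableEq V] [Fintype V] [DecidableEq E'] in
/-- A configuration below the image mask is an extension (of its restriction along `ι`). -/
theorem eq_ext_of_le (ι : E' → Fin k) (hι : Function.Injective ι) {ω : Config (Fin k)}
    (hω : ω ≤ imageMask ι) : ext ι (fun e => ω (ι e)) = ω := by
  funext f
  by_cases hf : ∃ e, ι e = f
  · obtain ⟨e, rfl⟩ := hf
    exact ext_apply ι hι _ e
  · have hf' : ∀ e, ι e ≠ f := fun e he => hf ⟨e, he⟩
    rw [ext_apply_of_not ι _ hf']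
    have h1 : imageMask ι f = false := ext_apply_of_not ι _ hf'
    have h2 := Config.le_iff.mp hω f
    cases hωf : ω f
    · rfl
    · rw [h2 hωf] at h1
      exact h1.symm

omit [DecidableEq V] [Fintype V] [DecidableEq E'] in
/-- Open adjacency agrees along the extension. -/
theorem openAdj_ext_iff {ι : E' → Fin k} (h : G.SubOf H ι) (ρ : Config E') (x y : V) :
    H.OpenAdj (ext ι ρ) x y ↔ G.OpenAdj ρ x y := by
  constructor
  · rintro ⟨f, hf, hend⟩
    unfold ext at hf
    rw [decide_eq_true_iff] at hf
    obtain ⟨e, rfl, hρ⟩ := hf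
    refine ⟨e, hρ, ?_⟩
    rcases h.2 e with ⟨h1, h2⟩ | ⟨h1, h2⟩ <;> rw [h1, h2] at hend
    · exact hend
    · rcases hend with ⟨ha, hb⟩ | ⟨ha, hb⟩
      · exact Or.inr ⟨hb, ha⟩
      · exact Or.inl ⟨hb, ha⟩
  · rintro ⟨e, hρ, hend⟩
    refine ⟨ι e, by rw [ext_apply ι h.1]; exact hρ, ?_⟩
    rcases h.2 e with ⟨h1, h2⟩ | ⟨h1, h2⟩ <;> rw [h1, h2]
    · exact hend
    · rcases hend with ⟨ha, hb⟩ | ⟨ha, hb⟩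
      · exact Or.inr ⟨hb, ha⟩
      · exact Or.inl ⟨hb, ha⟩

omit [DecidableEq V] [Fintype V] [DecidableEq E'] in
/-- Connectivity agrees along the extension. -/
theorem conn_ext_iff {ι : E' → Fin k} (h : G.SubOf H ι) (ρ : Config E') (x y : V) :
    H.Conn (ext ι ρ) x y ↔ G.Conn ρ x y := by
  unfold Conn
  constructor
  · intro hc
    induction hc with
    | refl => exact Relation.ReflTransGen.refl
    | tail _ hab ih => exact ih.tail ((G.openAdj_ext_iff H h ρ _ _).mp hab)
  · intro hc
    induction hc with
    | refl => exact Relation.ReflTransGen.refl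
    | tail _ hab ih => exact ih.tail ((G.openAdj_ext_iff H h ρ _ _).mpr hab)

omit [DecidableEq E'] in
/-- The rows agree along the extension. -/
theorem row4D_ext {ι : E' → Fin k} (h : G.SubOf H ι) (m : Fin 4 → V) (ρ : Config E') :
    H.row4D m (ext ι ρ) = G.row4D m ρ := by
  unfold row4D
  congr 1
  funext a
  rw [connD_eq_decide, connD_eq_decide]
  exact decide_eq_decide.mpr (G.conn_ext_iff H h ρ _ _)

/-- **The full-cube class sum of a subgraph is the face slack `[⊥, u_ι]` of the supergraph.** -/
theorem cubeSumC011_eq_faceSlackZ_sub {ι : E' → Fin k} (h : G.SubOf H ι) (m : Fin 4 → V) :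
    G.cubeSumC011 m = (H.faceSlackZ m (imageMask ι) ⊥ : ℝ) := by
  rw [G.cubeSumC011_eq_faceSlackZ_top m]
  unfold faceSlackZ
  push_cast
  refine Finset.sum_nbij' (fun ρ => ext ι ρ) (fun ω => fun e => ω (ι e)) ?_ ?_ ?_ ?_ ?_
  · intro ρ _
    exact Finset.mem_filter.mpr ⟨Finset.mem_univ _, bot_le, ext_le_imageMask ι ρ⟩
  · intro ω _
    exact Finset.mem_filter.mpr ⟨Finset.mem_univ _, bot_le, le_top⟩
  · intro ρ _
    funext e
    exact ext_apply ι h.1 ρ e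
  · intro ω hω
    exact eq_ext_of_le ι h.1 (Finset.mem_filter.mp hω).2.2
  · intro ρ _
    rw [antipode_top_bot, ← ext_compl ι h.1, row4D_ext G H h, row4D_ext G H h]

/-- **Lemma B⁺ on every face of the supergraph gives `0 ≤ CS` for the subgraph.** -/
theorem cubeSumC011_nonneg_of_facesBPlus_sub {ι : E' → Fin k} (h : G.SubOf H ι) (m : Fin 4 → V)
    (hH : H.FacesBPlus m) : 0 ≤ G.cubeSumC011 m := by
  rw [G.cubeSumC011_eq_faceSlackZ_sub H h m]
  exact_mod_cast hH (imageMask ι) ⊥ bot_le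

end MultiGraph

end PercRepro
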